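import Summits.QuantumFields.BalabanUV.T4Continuum.Support.NE7MinActMultiplier
import Summits.QuantumFields.BalabanUV.T4Continuum.Support.NE7SecondOrderChainRuleVec
import Summits.QuantumFields.BalabanUV.T4Continuum.Support.NE7SecondOrderChainRule
import Summits.QuantumFields.BalabanUV.T4Continuum.Support.NE7FibreStraightening
import HarnessLib

/-!
# NE7MinActHessianLagrangian — THE HESSIAN OF THE CONSTRAINED MINIMAL ACTION AT EVERY SMALL DATUM IS THE CONSTRAINED MINIMUM OF THE HESSIAN OF THE LAGRANGIAN (the bordered-Hessian
# ∕ second-order envelope theorem with the averaging constraint; ROAD-G115 §5 (iii) — ✓ `NE7MinActHessianFlat` is its flat special case, where `Dm(0) = 0`)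

Around every minimiser `U♯` over a small unitary `N`-periodic `V₀` satisfying the lift hypothesis (G3′) (✓ p824904 proves it at every small datum): with `𝒜 = fineAction∘chart_{U♯}` and
`𝒢 = levelQ∘chart_{U♯}` (the `(j+1)`-fold averaging read in the charts) on `skewSub M`, `m = minAct∘chart_{V₀}` on `skewSub N`, `Q′ = levelQ′ L N j U♯ = D𝒢(0)`, `w = stepWt⁻ʲ⁻¹`:
`m` is `C²` at `0` and for every coarse direction `v`
  `D²m(0)[v, v] = min { w·D²𝒜(0)[X, X] − Dm(0)[D²𝒢(0)[X, X]] : X ∈ skewSub M, Q′X = v }`, the minimum ATTAINED (**`minAct_hessian_lagrangian_of_lift`**, stated with `IsLeast`).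
Since `w·D𝒜(0) = Dm(0)∘Q′` (✓ `NE7MinActMultiplier`: the multiplier is `λ = w⁻¹·Dm(0)`), the minimised quantity is `w·D²(𝒜 − λ∘𝒢)(0)[X,X]` — the Hessian of the LAGRANGIAN of the
constrained problem, i.e. the quadratic form of the effective action around the background `U♯ = U_{j+1}(V₀)` in its variational form.
MECHANISM.  (attained) the Schur formula of ✓ `NE7MinActC2Lift` (`D²m(0)[v,v] = w·D²g(0)[u⋆]²`, `g = 𝒜∘Θ`, `u⋆ = (v, z⋆′(0)v)`), the second-order chain rule ✓ `fderiv_fderiv_comp`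
(`D²g(0)[u⋆]² = D²𝒜(0)[X⋆]² + D𝒜(0)[D²Θ(0)[u⋆]²]`, `X⋆ = DΘ(0)u⋆`), the multiplier identity, and THE SECOND-ORDER CONSTRAINT IDENTITY ✓ `NE7SecondOrderChainRuleVec.fderiv_apply_second_eq_neg`
(`𝒢(Θ(t u⋆)) = t v` ⇒ `Q′(D²Θ(0)[u⋆]²) = −D²𝒢(0)[X⋆]²`); (lower bound) for `X` with `Q′X = v` the fibre straightening `θ` (✓ p821389) gives admissible competitors `chart θ(tv, tX)` over
`chart_{V₀}(tv)`: `φ(t) = w·𝒜(θ(tv,tX)) − m(tv) ≥ 0 = φ(0)`, `φ″(0) ≥ 0` (✓ p823109, `c = 0`), `φ″(0) = w·D²𝒜(0)[X]² − Dm(0)[D²𝒢(0)[X]²] − D²m(0)[v]²` by the same three identities with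
`Dθ(0)(Q′X, X) = X` and `𝒢(θ(tv, tX)) = tv`.
Cell `pub-balaban`, rung (B)+1 sub-cell t4, lineage `b2b-balaban-t4-ne7-p1` (CRUX PROVER NE7 #1 = OWNER of BINDER row NE7), generation 115.  Memo `t4/b2b-balaban-t4-ne7-p1-g115/ROAD-G115.md` §5.
WHAT ([folklore]; 0 def, 0 sorry; `d = 4`, every `U(n)`, `L ≥ 2`).  HONEST FRAMING (page 1): composition of landed kernel theorems over OUR minimisers (B11 (8) with `sfClass`); (G3′) a
HYPOTHESIS here (discharged level by level by row NE7b's lifting); radii existential; a VARIATIONAL characterisation — no operator formula, no spectral bounds, no `k`-uniformity; nothing of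
Bałaban's asserted; NOT NE7 as a spine node, NOT NE3; spine 0∕9; finite T⁴ rung (B)+1 — NOT infinite volume, NOT mass gap, NOT BetaPertH, NOT Clay.
-/

set_option autoImplicit false

open scoped BigOperators Matrix Matrix.Norms.L2Operator Topology
open NormedSpace Finset Set Filter Metric

namespace Summit.QuantumFields.BalabanUV.T4Continuum.NE7MinActHessianLagrangian

open Literature.MathematicalPhysics.QuantumFieldTheory.Balaban1983to89
open B7Prop1Explicit B7Prop2Explicit
open T4AveragingDeficitWall (IsUnitaryCfg SmallField fineAction)
open T4AveragingDeficitWallBoundary (IsPeriodicCfg)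
open AveragingDeficitTorusChart (TDir chart chartDir chart_zero chart_smul redN isPeriodicCfg_chart isUnitaryCfg_chart)
open AveragingDeficitChartCalculus (relLog relLog_self contDiffAt_fineAction_chart)
open AveragingDeficitTwoLevelPrep (skewSub skewPR)
open AveragingDeficitMultiLevelPrep (tower levelQ levelQ' levelQ_self tower_ne_zero)
open AveragingDeficitMultiLevelBridge (tower_eq)
open AveragingDeficitMultiLevelFermat (hasStrictFDerivAt_levelQ)
open MinimalActionLevels (perWin levelAction stepWt stepWt_pos)
open MinimalActionSandwich (IsMinimiser admissible minAct)
open MinimalActionRate (sfClass)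
open NE3EnergyShapes (IsUnitarySite IsPeriodicSite)
open NE7AdmissibleFibreLHC (chart_id_eq_chart_skewP)
open NE7MinimalOrbitDatumContinuity (thresholds)
open NE7MinimalOrbitUniqueGeneric (minimal_orbit_unique_generic)
open BlockAverageCurrent (smallField_gaugeAct)
open NE7MinimiserLipschitzPrep (norm_vary_sub_le)
open NE7FibreStraightening (contDiffAt_levelQ fibre_straightening)
open NE7QuadraticGrowthSecondDerivative (second_derivative_ge_of_quadratic_growth)
open NE7SecondOrderChainRule (fderiv_fderiv_comp fderiv_fderiv_comp_clm fderiv_fderiv_const_mul_sub)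
open NE7SecondOrderChainRuleVec (fderiv_fderiv_comp_clm_vec fderiv_apply_second_eq_neg)
open NE7MinActC2Lift (minAct_contDiffAt_two_of_lift)
open NE7MinActMultiplier (multiplier_eq_fderiv_minAct_of_lift)

noncomputable section

variable {n : Type} [Fintype n] [DecidableEq n]

set_option maxHeartbeats 3200000 in
/-- **THE BORDERED HESSIAN OF THE CONSTRAINED MINIMAL ACTION** (see the module docstring). [folklore] -/
theorem minAct_hessian_lagrangian_of_lift [Nonempty n] {L : ℕ} [NeZero L] (hL : 2 ≤ L) :
    ∃ ε₀ : ℝ, 0 < ε₀ ∧ ∀ ε : ℝ, 0 < ε → ε ≤ ε₀ → ∀ (N : ℕ) [NeZero N], 1 ≤ N →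
      ∃ δV : ℝ, 0 < δV ∧
        ∀ V₀ ∈ {V : Site 4 → Fin 4 → (Matrix n n ℂ)ˣ | IsUnitaryCfg V ∧ IsPeriodicCfg V (N : ℤ) ∧ SmallField V δV},
        ∀ (j : ℕ) (Us : Site 4 → Fin 4 → (Matrix n n ℂ)ˣ), IsMinimiser 4 (sfClass 4 L N ε) L N (j + 1) V₀ Us →
        (∀ s : Site 4 → (Matrix n n ℂ)ˣ, IsUnitarySite s → IsPeriodicSite s (N : ℤ) → gaugeAct s V₀ = V₀ →
            ∃ h : Site 4 → (Matrix n n ℂ)ˣ, IsUnitarySite h ∧ IsPeriodicSite h ((N * L ^ (j + 1) : ℕ) : ℤ) ∧ gaugeAct h Us = Us ∧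
              ∀ z : Site 4, h (((L : ℤ) ^ (j + 1)) • z) = s z) →
        ContDiffAt ℝ 2 (fun y : ↥(skewSub 4 n N) => minAct 4 (sfClass 4 L N ε) L N (j + 1) (chart (ContinuousLinearMap.id ℝ (Matrix n n ℂ)) N V₀ (y : TDir 4 n N))) 0 ∧
        ∀ v : ↥(skewSub 4 n N),
          IsLeast {q : ℝ | ∃ X : ↥(skewSub 4 n (L * tower L N j)), levelQ' L N j Us (X : TDir 4 n (L * tower L N j)) = v ∧
              q = ((stepWt 4 L)⁻¹) ^ (j + 1) * fderiv ℝ (fderiv ℝ (fun Φ : ↥(skewSub 4 n (L * tower L N j)) => fineAction (chart (ContinuousLinearMap.id ℝ (Matrix n n ℂ)) (L * tower L N j) Us (Φ : TDir 4 n (L * tower L N j))) (perWin 4 (N * L ^ (j + 1))))) 0 X X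
                  - fderiv ℝ (fun y : ↥(skewSub 4 n N) => minAct 4 (sfClass 4 L N ε) L N (j + 1) (chart (ContinuousLinearMap.id ℝ (Matrix n n ℂ)) N V₀ (y : TDir 4 n N))) 0 (fderiv ℝ (fderiv ℝ (fun Φ : ↥(skewSub 4 n (L * tower L N j)) => levelQ L N j Us (chart (ContinuousLinearMap.id ℝ (Matrix n n ℂ)) (L * tower L N j) Us (Φ : TDir 4 n (L * tower L N j))))) 0 X X)}
            (fderiv ℝ (fderiv ℝ (fun y : ↥(skewSub 4 n N) => minAct 4 (sfClass 4 L N ε) L N (j + 1) (chart (ContinuousLinearMap.id ℝ (Matrix n n ℂ)) N V₀ (y : TDir 4 n N)))) 0 v v) := by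
  have hL1 : 1 ≤ L := by omega
  obtain ⟨ε₁, hε₁, H⟩ := thresholds (n := n) hL
  obtain ⟨ε₂, hε₂, H2⟩ := minAct_contDiffAt_two_of_lift (n := n) hL
  obtain ⟨ε₃, hε₃, H3⟩ := minimal_orbit_unique_generic (n := n) hL
  obtain ⟨ε₄, hε₄, H4⟩ := multiplier_eq_fderiv_minAct_of_lift (n := n) hL
  refine ⟨min ε₁ (min ε₂ (min ε₃ ε₄)), lt_min hε₁ (lt_min hε₂ (lt_min hε₃ hε₄)), fun ε hε hεle N _ hN => ?_⟩
  obtain ⟨-, -, hls, H1⟩ := H ε hε (hεle.trans (min_le_left _ _))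
  obtain ⟨δ₁, hδ₁, hint₁⟩ := H1 N hN
  obtain ⟨δ₂, hδ₂, hC2⟩ := H2 ε hε (hεle.trans ((min_le_right _ _).trans (min_le_left _ _))) N hN
  obtain ⟨δ₃, hδ₃, huniq⟩ := H3 ε hε (hεle.trans ((min_le_right _ _).trans ((min_le_right _ _).trans (min_le_left _ _)))) N hN
  obtain ⟨δ₄, hδ₄, hmult⟩ := H4 ε hε (hεle.trans ((min_le_right _ _).trans ((min_le_right _ _).trans (min_le_right _ _)))) N hN
  refine ⟨min δ₁ (min δ₂ (min δ₃ δ₄)), lt_min hδ₁ (lt_min hδ₂ (lt_min hδ₃ hδ₄)), fun V₀ hV₀ j Us hUs hlift => ?_⟩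
  obtain ⟨hV₀u, hV₀P, hV₀δ⟩ := hV₀
  have hV₀1 : V₀ ∈ {V : Site 4 → Fin 4 → (Matrix n n ℂ)ˣ | IsUnitaryCfg V ∧ IsPeriodicCfg V (N : ℤ) ∧ SmallField V δ₁} :=
    ⟨hV₀u, hV₀P, MinimalActionRate.SmallField.mono hV₀δ (min_le_left _ _)⟩
  have hV₀2 : V₀ ∈ {V : Site 4 → Fin 4 → (Matrix n n ℂ)ˣ | IsUnitaryCfg V ∧ IsPeriodicCfg V (N : ℤ) ∧ SmallField V δ₂} :=
    ⟨hV₀u, hV₀P, MinimalActionRate.SmallField.mono hV₀δ ((min_le_right _ _).trans (min_le_left _ _))⟩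
  have hV₀3 : V₀ ∈ {V : Site 4 → Fin 4 → (Matrix n n ℂ)ˣ | IsUnitaryCfg V ∧ IsPeriodicCfg V (N : ℤ) ∧ SmallField V δ₃} :=
    ⟨hV₀u, hV₀P, MinimalActionRate.SmallField.mono hV₀δ ((min_le_right _ _).trans ((min_le_right _ _).trans (min_le_left _ _)))⟩
  have hV₀4 : V₀ ∈ {V : Site 4 → Fin 4 → (Matrix n n ℂ)ˣ | IsUnitaryCfg V ∧ IsPeriodicCfg V (N : ℤ) ∧ SmallField V δ₄} :=
    ⟨hV₀u, hV₀P, MinimalActionRate.SmallField.mono hV₀δ ((min_le_right _ _).trans ((min_le_right _ _).trans (min_le_right _ _)))⟩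
  -- interiority of `U♯`
  obtain ⟨U₀, hU₀, a, ha0, haε, hU₀a⟩ := hint₁ V₀ hV₀1 (j + 1)
  obtain ⟨Ur, -, horbit⟩ := huniq V₀ hV₀3 (j + 1)
  obtain ⟨u₁, hu₁, -, hg₁⟩ := horbit U₀ hU₀
  obtain ⟨u₂, hu₂, -, hg₂⟩ := horbit Us hUs
  have hUsa : SmallField Us a := by
    have h1 : SmallField Ur a := by rw [← hg₁]; exact smallField_gaugeAct hu₁ hU₀a
    have h2 : gaugeAct (fun z => (u₂ z)⁻¹) Ur = Us := by rw [← hg₂, AveragingDeficitKDatum.gaugeAct_inv_gaugeAct]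
    rw [← h2]; exact smallField_gaugeAct (fun z => (unitaryUnits _).inv_mem (hu₂ z)) h1
  haveI : NeZero (L * tower L N j) := ⟨Nat.mul_ne_zero (NeZero.ne L) (tower_ne_zero L N j)⟩
  haveI : CompleteSpace ↥(skewSub 4 n (L * tower L N j)) := FiniteDimensional.complete ℝ _
  haveI : CompleteSpace ↥(skewSub 4 n N) := FiniteDimensional.complete ℝ _
  -- the `C²` package (Schur Hessian) and the multiplier identity
  obtain ⟨Sl, θS, KT, iK, zs, hSlle, hθSc, hθS0, hfib1, -, hzsc, hzs0, hkey, -, -, hM2, hHess, -⟩ := hC2 V₀ hV₀2 j Us hUs hlift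
  obtain ⟨-, hstar⟩ := hmult V₀ hV₀4 j Us hUs hlift
  haveI : CompleteSpace ↥Sl := FiniteDimensional.complete ℝ _
  haveI : CompleteSpace ↥KT := FiniteDimensional.complete ℝ _
  refine ⟨hM2, fun v => ?_⟩
  set W := perWin 4 (N * L ^ (j + 1)) with hW
  set w : ℝ := ((stepWt 4 L)⁻¹) ^ (j + 1) with hw
  have hw0 : 0 < w := pow_pos (inv_pos.mpr (stepWt_pos (d := 4) L hL1)) _
  have hlev : ∀ Z : Site 4 → Fin 4 → (Matrix n n ℂ)ˣ, levelAction 4 L N (j + 1) Z = w * fineAction Z W := fun Z => by rw [hw, hW]; rfl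
  have hUsU : IsUnitaryCfg Us := hUs.mem.1.1
  have eP : ((N * L ^ (j + 1) : ℕ) : ℤ) = (L : ℤ) * (tower L N j : ℕ) := by rw [tower_eq]; push_cast; ring
  have hUsP' : IsPeriodicCfg Us ((L : ℤ) * (tower L N j : ℕ)) := by rw [← eP]; exact hUs.mem.1.2.1
  set x₀ : ℝ := ε / ((L : ℝ) ^ (j + 1)) ^ 2 with hx₀
  have hx₀0 : 0 < x₀ := by positivity
  have hUsx : SmallField Us x₀ := hUs.mem.1.2.2
  set A : ↥(skewSub 4 n (L * tower L N j)) → ℝ := fun Φ => fineAction (chart (ContinuousLinearMap.id ℝ (Matrix n n ℂ)) (L * tower L N j) Us (Φ : TDir 4 n (L * tower L N j))) W with hA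
  set G : ↥(skewSub 4 n (L * tower L N j)) → ↥(skewSub 4 n N) := fun Φ => levelQ L N j Us (chart (ContinuousLinearMap.id ℝ (Matrix n n ℂ)) (L * tower L N j) Us (Φ : TDir 4 n (L * tower L N j))) with hGdef
  set m : ↥(skewSub 4 n N) → ℝ := fun y => minAct 4 (sfClass 4 L N ε) L N (j + 1) (chart (ContinuousLinearMap.id ℝ (Matrix n n ℂ)) N V₀ (y : TDir 4 n N)) with hm
  have hAc : ContDiffAt ℝ 2 A 0 := by
    have h1 : ContDiffAt ℝ 2 (fun Φ : TDir 4 n (L * tower L N j) => fineAction (chart (ContinuousLinearMap.id ℝ (Matrix n n ℂ)) (L * tower L N j) Us Φ) W) ((skewSub 4 n (L * tower L N j)).subtypeL 0) := by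
      rw [map_zero]; exact contDiffAt_fineAction_chart (m := 2) (ContinuousLinearMap.id ℝ (Matrix n n ℂ)) (L * tower L N j) Us W 0
    exact h1.comp 0 (skewSub 4 n (L * tower L N j)).subtypeL.contDiff.contDiffAt
  have hGc : ContDiffAt ℝ 2 G 0 := by
    have h1 : ContDiffAt ℝ 2 (fun Φ : TDir 4 n (L * tower L N j) => levelQ L N j Us (chart (ContinuousLinearMap.id ℝ (Matrix n n ℂ)) (L * tower L N j) Us Φ)) ((skewSub 4 n (L * tower L N j)).subtypeL 0) := by
      rw [map_zero]; exact contDiffAt_levelQ (d := 4) (m := 2) hL1 j hUsU hUsP' hx₀0.le (hls j) hUsx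
    exact h1.comp 0 (skewSub 4 n (L * tower L N j)).subtypeL.contDiff.contDiffAt
  have hG : HasStrictFDerivAt (fun Φ : TDir 4 n (L * tower L N j) => levelQ L N j Us (chart (ContinuousLinearMap.id ℝ (Matrix n n ℂ)) (L * tower L N j) Us Φ)) (levelQ' L N j Us) 0 :=
    hasStrictFDerivAt_levelQ (d := 4) hL1 j hUsU hUsP' hx₀0.le (hls j) hUsx
  have hGs : HasFDerivAt G ((levelQ' L N j Us).comp (skewSub 4 n (L * tower L N j)).subtypeL) 0 := by
    have h1 : HasFDerivAt (fun Φ : TDir 4 n (L * tower L N j) => levelQ L N j Us (chart (ContinuousLinearMap.id ℝ (Matrix n n ℂ)) (L * tower L N j) Us Φ)) (levelQ' L N j Us)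
        ((skewSub 4 n (L * tower L N j)).subtypeL 0) := by rw [map_zero]; exact hG.hasFDerivAt
    exact h1.comp 0 (skewSub 4 n (L * tower L N j)).subtypeL.hasFDerivAt
  have hGs' : ∀ Z : ↥(skewSub 4 n (L * tower L N j)), fderiv ℝ G 0 Z = levelQ' L N j Us (Z : TDir 4 n (L * tower L N j)) := fun Z => by
    rw [hGs.fderiv]; rfl
  have hG0 : G 0 = 0 := by simp only [hGdef, Submodule.coe_zero, chart_zero, levelQ_self]
  have hA0 : A 0 = fineAction Us W := by simp only [hA, Submodule.coe_zero, chart_zero]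
  have hm0 : m 0 = w * fineAction Us W := by
    simp only [hm, Submodule.coe_zero, chart_zero]; rw [hUs.minAct_eq, hlev]
  -- the multiplier identity turned into the second-order correction along a constrained curve
  have hcorr : ∀ (c : ℝ → ↥(skewSub 4 n (L * tower L N j))), ContDiffAt ℝ 2 c 0 → c 0 = 0 →
      ((fun t : ℝ => G (c t)) =ᶠ[𝓝 0] fun t : ℝ => t • v) →
      w * fderiv ℝ A 0 (fderiv ℝ (fderiv ℝ c) 0 1 1) = -(fderiv ℝ m 0 (fderiv ℝ (fderiv ℝ G) 0 (fderiv ℝ c 0 1) (fderiv ℝ c 0 1))) := by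
    intro c hcc hc0 hlin
    have hGcc : ContDiffAt ℝ 2 G (c 0) := by rw [hc0]; exact hGc
    have h := fderiv_apply_second_eq_neg hGcc hcc hlin
    rw [hc0, hGs'] at h
    rw [hstar, h, map_neg]
  constructor
  · -- ATTAINED at `X⋆ = DΘ(0)(v, z⋆′(0)v)`
    set inclSl : ↥Sl →L[ℝ] ↥(skewSub 4 n (L * tower L N j)) := LinearMap.toContinuousLinearMap (Submodule.inclusion hSlle) with hinclSl
    set ι : ↥(skewSub 4 n N) × ↥KT →L[ℝ] ↥(skewSub 4 n N) × ↥Sl := (ContinuousLinearMap.id ℝ ↥(skewSub 4 n N)).prodMap iK with hι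
    set Θ : ↥(skewSub 4 n N) × ↥KT → ↥(skewSub 4 n (L * tower L N j)) := fun p => inclSl (θS (ι p)) with hΘ
    have hιp : ∀ p : ↥(skewSub 4 n N) × ↥KT, ι p = (p.1, iK p.2) := fun p => rfl
    have hΘval : ∀ p : ↥(skewSub 4 n N) × ↥KT, ((Θ p : ↥(skewSub 4 n (L * tower L N j))) : TDir 4 n (L * tower L N j)) = ((θS (p.1, iK p.2) : ↥Sl) : TDir 4 n (L * tower L N j)) := fun p => rfl
    have hgΘ : (fun p : ↥(skewSub 4 n N) × ↥KT => fineAction (chart (ContinuousLinearMap.id ℝ (Matrix n n ℂ)) (L * tower L N j) Us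
        ((θS (p.1, iK p.2) : ↥Sl) : TDir 4 n (L * tower L N j))) (perWin 4 (N * L ^ (j + 1)))) = fun p => A (Θ p) := by
      funext p
      show _ = fineAction (chart (ContinuousLinearMap.id ℝ (Matrix n n ℂ)) (L * tower L N j) Us ((Θ p : ↥(skewSub 4 n (L * tower L N j))) : TDir 4 n (L * tower L N j))) W
      rw [hΘval p]
    have hΘ0 : Θ 0 = 0 := by simp only [hΘ, map_zero, hθS0]
    have hΘc : ContDiffAt ℝ 2 Θ 0 := by
      have h1 : ContDiffAt ℝ 2 θS (ι 0) := by rw [map_zero]; exact hθSc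
      exact inclSl.contDiff.contDiffAt.comp 0 (h1.comp 0 ι.contDiff.contDiffAt)
    have hΘd : HasFDerivAt Θ (inclSl.comp ((fderiv ℝ θS 0).comp ι)) 0 := by
      have h1 : HasFDerivAt θS (fderiv ℝ θS 0) (ι 0) := by rw [map_zero]; exact (hθSc.differentiableAt (by simp)).hasFDerivAt
      exact inclSl.hasFDerivAt.comp 0 (h1.comp 0 ι.hasFDerivAt)
    set ζ : ↥KT := fderiv ℝ zs 0 v with hζ
    set Xs : ↥(skewSub 4 n (L * tower L N j)) := fderiv ℝ Θ 0 (v, ζ) with hXs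
    have hXsval : ((Xs : ↥(skewSub 4 n (L * tower L N j))) : TDir 4 n (L * tower L N j)) = ((fderiv ℝ θS 0 (v, iK ζ) : ↥Sl) : TDir 4 n (L * tower L N j)) := by
      rw [hXs, hΘd.fderiv]
      simp only [ContinuousLinearMap.comp_apply, hιp, hinclSl, LinearMap.coe_toContinuousLinearMap', Submodule.coe_inclusion]
    refine ⟨Xs, ?_, ?_⟩
    · -- `Q′ X⋆ = v`
      have hΘd' : HasFDerivAt (fun p : ↥(skewSub 4 n N) × ↥Sl => ((θS p : ↥Sl) : TDir 4 n (L * tower L N j))) (Sl.subtypeL.comp (fderiv ℝ θS 0)) 0 :=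
        Sl.subtypeL.hasFDerivAt.comp 0 (hθSc.differentiableAt (by simp)).hasFDerivAt
      have hΘ0' : (fun p : ↥(skewSub 4 n N) × ↥Sl => ((θS p : ↥Sl) : TDir 4 n (L * tower L N j))) 0 = 0 := by simp only [hθS0, Submodule.coe_zero]
      have hG' : HasFDerivAt (fun Φ : TDir 4 n (L * tower L N j) => levelQ L N j Us (chart (ContinuousLinearMap.id ℝ (Matrix n n ℂ)) (L * tower L N j) Us Φ)) (levelQ' L N j Us)
          ((fun p : ↥(skewSub 4 n N) × ↥Sl => ((θS p : ↥Sl) : TDir 4 n (L * tower L N j))) 0) := by rw [hΘ0']; exact hG.hasFDerivAt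
      have hF := hG'.comp 0 hΘd'
      have hF' : HasFDerivAt (fun p : ↥(skewSub 4 n N) × ↥Sl => levelQ L N j Us (chart (ContinuousLinearMap.id ℝ (Matrix n n ℂ)) (L * tower L N j) Us ((θS p : ↥Sl) : TDir 4 n (L * tower L N j))))
          (ContinuousLinearMap.fst ℝ ↥(skewSub 4 n N) ↥Sl) 0 :=
        (hasFDerivAt_fst (𝕜 := ℝ) (p := (0 : ↥(skewSub 4 n N) × ↥Sl))).congr_of_eventuallyEq (hfib1.mono fun p hp => hp)
      have h := congrArg (fun T : ↥(skewSub 4 n N) × ↥Sl →L[ℝ] ↥(skewSub 4 n N) => T (v, iK ζ)) (hF.unique hF')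
      simp only [ContinuousLinearMap.comp_apply, Submodule.subtypeL_apply, ContinuousLinearMap.coe_fst'] at h
      rw [hXsval]; exact h
    · -- the value: Schur formula + second-order chain rule + multiplier + constraint identity along `t ↦ Θ(t u⋆)`
      have hAcΘ : ContDiffAt ℝ 2 A (Θ 0) := by rw [hΘ0]; exact hAc
      have hD2 := fderiv_fderiv_comp hAcΘ hΘc (v, ζ) (v, ζ)
      rw [hΘ0] at hD2
      set ℓs : ℝ →L[ℝ] ↥(skewSub 4 n N) × ↥KT := ContinuousLinearMap.toSpanSingleton ℝ ((v, ζ) : ↥(skewSub 4 n N) × ↥KT) with hℓs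
      have hℓs1 : ℓs 1 = (v, ζ) := ContinuousLinearMap.toSpanSingleton_apply_one ℝ _
      have hcs : ContDiffAt ℝ 2 (fun t : ℝ => Θ (ℓs t)) 0 := by
        have h1 : ContDiffAt ℝ 2 Θ (ℓs 0) := by rw [map_zero]; exact hΘc
        exact ContDiffAt.comp (g := Θ) (f := fun t : ℝ => ℓs t) 0 h1 ℓs.contDiff.contDiffAt
      have hcs0 : (fun t : ℝ => Θ (ℓs t)) 0 = 0 := by simp only [map_zero, hΘ0]
      have hcs' : fderiv ℝ (fun t : ℝ => Θ (ℓs t)) 0 1 = Xs := by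
        have h1 : ∀ p : ↥(skewSub 4 n N) × ↥KT, p = 0 → HasFDerivAt Θ (fderiv ℝ Θ 0) p := fun p hp => by rw [hp]; exact hΘd.differentiableAt.hasFDerivAt
        have h2 : HasFDerivAt (fun t : ℝ => Θ (ℓs t)) ((fderiv ℝ Θ 0).comp ℓs) 0 := (h1 _ (map_zero ℓs)).comp 0 ℓs.hasFDerivAt
        rw [h2.fderiv, ContinuousLinearMap.comp_apply, hℓs1]
      have hcs'' : fderiv ℝ (fderiv ℝ (fun t : ℝ => Θ (ℓs t))) 0 1 1 = fderiv ℝ (fderiv ℝ Θ) 0 (v, ζ) (v, ζ) := by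
        have h1 : ContDiffAt ℝ 2 Θ (ℓs 0) := by rw [map_zero]; exact hΘc
        rw [fderiv_fderiv_comp_clm_vec ℓs h1, map_zero, hℓs1]
      have hlin : (fun t : ℝ => G (Θ (ℓs t))) =ᶠ[𝓝 0] fun t : ℝ => t • v := by
        have ht : Tendsto (fun t : ℝ => ι (ℓs t)) (𝓝 0) (𝓝 0) := by
          have h := (ι.comp ℓs).continuous.tendsto (0 : ℝ); rwa [map_zero] at h
        filter_upwards [ht.eventually hfib1] with t hft
        show levelQ L N j Us (chart (ContinuousLinearMap.id ℝ (Matrix n n ℂ)) (L * tower L N j) Us ((Θ (ℓs t) : ↥(skewSub 4 n (L * tower L N j))) : TDir 4 n (L * tower L N j))) = t • v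
        rw [hΘval, ← hιp, hft]
        simp only [hιp, hℓs, ContinuousLinearMap.toSpanSingleton_apply, Prod.smul_fst]
      have hc := hcorr (fun t : ℝ => Θ (ℓs t)) hcs hcs0 hlin
      rw [hcs', hcs''] at hc
      rw [hHess v v, hgΘ, hD2, mul_add, hc]
      ring
  · -- THE LOWER BOUND: for every `X` with `Q′X = v`
    rintro q ⟨X, hXv, rfl⟩
    obtain ⟨θ, -, ρ₀, -, hρ₀, hθ0, hθc, -, hθid, hθfib⟩ :=
      fibre_straightening (d := 4) (n := n) hL1 hε.le (hls j) hUs.mem haε hUsa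
    -- `Dθ(0)(Q′X, X) = X`
    have hJd : HasFDerivAt (fun Φ : ↥(skewSub 4 n (L * tower L N j)) => θ (G Φ, Φ))
        ((fderiv ℝ θ 0).comp (((levelQ' L N j Us).comp (skewSub 4 n (L * tower L N j)).subtypeL).prod (ContinuousLinearMap.id ℝ ↥(skewSub 4 n (L * tower L N j))))) 0 := by
      have h1 : ∀ p : ↥(skewSub 4 n N) × ↥(skewSub 4 n (L * tower L N j)), p = 0 → HasFDerivAt θ (fderiv ℝ θ 0) p := fun p hp => by
        rw [hp]; exact (hθc.differentiableAt (by simp)).hasFDerivAt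
      exact (h1 _ (by simp only [hG0, Prod.mk_zero_zero])).comp 0 (hGs.prodMk (hasFDerivAt_id (0 : ↥(skewSub 4 n (L * tower L N j)))))
    have hJid : HasFDerivAt (fun Φ : ↥(skewSub 4 n (L * tower L N j)) => θ (G Φ, Φ)) (ContinuousLinearMap.id ℝ ↥(skewSub 4 n (L * tower L N j))) 0 := by
      refine (hasFDerivAt_id (0 : ↥(skewSub 4 n (L * tower L N j)))).congr_of_eventuallyEq ?_
      filter_upwards [Metric.ball_mem_nhds (0 : ↥(skewSub 4 n (L * tower L N j))) hρ₀] with Φ hΦ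
      exact hθid Φ (by rwa [mem_ball_zero_iff] at hΦ)
    have hθ'X : fderiv ℝ θ 0 (v, X) = X := by
      have h := congrArg (fun T : ↥(skewSub 4 n (L * tower L N j)) →L[ℝ] ↥(skewSub 4 n (L * tower L N j)) => T X) (hJd.unique hJid)
      simp only [ContinuousLinearMap.comp_apply, ContinuousLinearMap.prod_apply, Submodule.subtypeL_apply, ContinuousLinearMap.id_apply] at h
      rw [hXv] at h; exact h
    -- the competitor curve and the comparison function `φ(t) = w·𝒜(θ(tv, tX)) − m(tv)`
    set ℓ : ℝ →L[ℝ] ↥(skewSub 4 n N) × ↥(skewSub 4 n (L * tower L N j)) := ContinuousLinearMap.toSpanSingleton ℝ ((v, X) : ↥(skewSub 4 n N) × ↥(skewSub 4 n (L * tower L N j))) with hℓ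
    set ℓ' : ℝ →L[ℝ] ↥(skewSub 4 n N) := ContinuousLinearMap.toSpanSingleton ℝ v with hℓ'
    have hℓ1 : ℓ 1 = (v, X) := ContinuousLinearMap.toSpanSingleton_apply_one ℝ _
    have hℓ'1 : ℓ' 1 = v := ContinuousLinearMap.toSpanSingleton_apply_one ℝ _
    have hℓfst : ∀ t : ℝ, (ℓ t).1 = ℓ' t := fun t => by simp only [hℓ, hℓ', ContinuousLinearMap.toSpanSingleton_apply, Prod.smul_fst]
    set f : ℝ → ℝ := fun t => A (θ (ℓ t)) with hf
    have hθℓc : ContDiffAt ℝ 2 (fun t : ℝ => θ (ℓ t)) 0 := by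
      have h1 : ContDiffAt ℝ 2 θ (ℓ 0) := by rw [map_zero]; exact hθc
      exact ContDiffAt.comp (g := θ) (f := fun t : ℝ => ℓ t) 0 h1 ℓ.contDiff.contDiffAt
    have hθℓ0 : (fun t : ℝ => θ (ℓ t)) 0 = 0 := by simp only [map_zero, hθ0]
    have hfc : ContDiffAt ℝ 2 f 0 := by
      have h2 : ContDiffAt ℝ 2 A (θ (ℓ 0)) := by rw [map_zero, hθ0]; exact hAc
      exact ContDiffAt.comp (g := A) (f := fun t : ℝ => θ (ℓ t)) 0 h2 hθℓc
    have hmℓc : ContDiffAt ℝ 2 (fun t : ℝ => m (ℓ' t)) 0 := by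
      have h1 : ContDiffAt ℝ 2 m (ℓ' 0) := by rw [map_zero]; exact hM2
      exact ContDiffAt.comp (g := m) (f := fun t : ℝ => ℓ' t) 0 h1 ℓ'.contDiff.contDiffAt
    have hφc : ContDiffAt ℝ 2 (fun t : ℝ => w * f t - m (ℓ' t)) 0 := (contDiffAt_const.mul hfc).sub hmℓc
    have hφ0 : w * f 0 - m (ℓ' 0) = 0 := by
      simp only [hf, map_zero, hθ0, hA0, hm0, sub_self]
    have htℓ : Tendsto (fun t : ℝ => ℓ t) (𝓝 0) (𝓝 0) := by have h := ℓ.continuous.tendsto 0; rwa [map_zero] at h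
    have htℓ' : Tendsto (fun t : ℝ => ℓ' t) (𝓝 0) (𝓝 0) := by have h := ℓ'.continuous.tendsto 0; rwa [map_zero] at h
    have hsmallρ : ∀ᶠ t : ℝ in 𝓝 0, ‖ℓ t‖ < ρ₀ :=
      htℓ.eventually (Filter.eventually_of_mem (Metric.ball_mem_nhds _ hρ₀) fun q hq => by rwa [mem_ball_zero_iff] at hq)
    have hsmall8 : ∀ᶠ t : ℝ in 𝓝 0, ‖ℓ' t‖ < 1 / 8 :=
      htℓ'.eventually (Filter.eventually_of_mem (Metric.ball_mem_nhds _ (by norm_num : (0:ℝ) < 1 / 8)) fun q hq => by rwa [mem_ball_zero_iff] at hq)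
    have hgrowth : ∀ᶠ t : ℝ in 𝓝 0, 0 * ‖t - 0‖ ^ 2 ≤ (w * f t - m (ℓ' t)) - (w * f 0 - m (ℓ' 0)) := by
      filter_upwards [hsmallρ, hsmall8, htℓ'.eventually hkey] with t htρ ht8 hmin
      rw [zero_mul, hφ0, sub_zero]
      set y : ↥(skewSub 4 n N) := ℓ' t with hy
      set D : Site 4 → Fin 4 → (Matrix n n ℂ)ˣ := chart (ContinuousLinearMap.id ℝ (Matrix n n ℂ)) N V₀ (y : TDir 4 n N) with hD
      have hDu : IsUnitaryCfg D := by rw [hD, chart_id_eq_chart_skewP V₀ y.2]; exact isUnitaryCfg_chart N hV₀u _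
      have hDP : IsPeriodicCfg D (N : ℤ) := isPeriodicCfg_chart _ N hV₀P _
      have hDnear : ∀ (r : Fin 4 → Fin N) (κ' : Fin 4),
          ‖(((V₀ (boxVec N r) κ')⁻¹ : (Matrix n n ℂ)ˣ) : Matrix n n ℂ) * (D (boxVec N r) κ' : Matrix n n ℂ) - 1‖ ≤ 1 / 4 := by
        intro r κ'
        have hcv : D = T4AveragingDeficitWall.vary V₀ (chartDir (ContinuousLinearMap.id ℝ (Matrix n n ℂ)) N (y : TDir 4 n N)) 1 := by
          rw [hD, ← chart_smul, one_smul]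
        have hcomp : ‖chartDir (ContinuousLinearMap.id ℝ (Matrix n n ℂ)) N (y : TDir 4 n N) (boxVec N r) κ'‖ ≤ ‖y‖ := by
          simp only [chartDir, ContinuousLinearMap.id_apply]
          rw [Submodule.coe_norm]
          exact (norm_le_pi_norm ((y : TDir 4 n N) (redN N (boxVec N r))) κ').trans (norm_le_pi_norm _ _)
        rw [hcv]
        exact (norm_vary_sub_le (W := V₀) (boxVec N r) κ' (hcomp.trans (by linarith))).trans (by linarith)
      have hDcoord : skewPR N (relLog N V₀ D) = y :=
        NE7MinimalActionDifferentiable.skewPR_relLog_chart_self V₀ y (lt_of_lt_of_le ht8 (by have := Real.log_two_gt_d9; linarith))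
      have hp1 : (ℓ t).1 = y := hℓfst t
      have hadm : chart (ContinuousLinearMap.id ℝ (Matrix n n ℂ)) (L * tower L N j) Us ((θ (ℓ t) : ↥(skewSub 4 n (L * tower L N j))) : TDir 4 n (L * tower L N j))
          ∈ admissible (sfClass 4 L N ε) L (j + 1) D :=
        (hθfib (ℓ t) htρ).2.2 D hDu hDP hDnear (by rw [hDcoord, hp1])
      have hle := hmin.minAct_le hadm
      rw [hlev] at hle
      show 0 ≤ w * A (θ (ℓ t)) - m y
      have e : m y = minAct 4 (sfClass 4 L N ε) L N (j + 1) D := rfl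
      rw [e]; linarith
    have hφ'' := second_derivative_ge_of_quadratic_growth hφc le_rfl hgrowth 1
    rw [zero_mul] at hφ''
    -- `φ″(0) = w·D²𝒜(0)[X,X] − Dm(0)[D²𝒢(0)[X,X]] − D²m(0)[v,v]`
    have hsplit := fderiv_fderiv_const_mul_sub hfc hmℓc w (1 : ℝ) 1
    have hm'' : fderiv ℝ (fderiv ℝ (fun t : ℝ => m (ℓ' t))) 0 1 1 = fderiv ℝ (fderiv ℝ m) 0 v v := by
      have h1 : ContDiffAt ℝ 2 m (ℓ' 0) := by rw [map_zero]; exact hM2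
      rw [fderiv_fderiv_comp_clm ℓ' h1, map_zero, hℓ'1]
    have hθℓ' : fderiv ℝ (fun t : ℝ => θ (ℓ t)) 0 1 = X := by
      have h1 : ∀ p : ↥(skewSub 4 n N) × ↥(skewSub 4 n (L * tower L N j)), p = 0 → HasFDerivAt θ (fderiv ℝ θ 0) p := fun p hp => by
        rw [hp]; exact (hθc.differentiableAt (by simp)).hasFDerivAt
      have h2 : HasFDerivAt (fun t : ℝ => θ (ℓ t)) ((fderiv ℝ θ 0).comp ℓ) 0 := (h1 _ (map_zero ℓ)).comp 0 ℓ.hasFDerivAt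
      rw [h2.fderiv, ContinuousLinearMap.comp_apply, hℓ1, hθ'X]
    have hθℓ'' : fderiv ℝ (fderiv ℝ (fun t : ℝ => θ (ℓ t))) 0 1 1 = fderiv ℝ (fderiv ℝ θ) 0 (v, X) (v, X) := by
      have h1 : ContDiffAt ℝ 2 θ (ℓ 0) := by rw [map_zero]; exact hθc
      rw [fderiv_fderiv_comp_clm_vec ℓ h1, map_zero, hℓ1]
    have hlin : (fun t : ℝ => G (θ (ℓ t))) =ᶠ[𝓝 0] fun t : ℝ => t • v := by
      filter_upwards [hsmallρ] with t htρ
      show levelQ L N j Us (chart (ContinuousLinearMap.id ℝ (Matrix n n ℂ)) (L * tower L N j) Us ((θ (ℓ t) : ↥(skewSub 4 n (L * tower L N j))) : TDir 4 n (L * tower L N j))) = t • v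
      rw [(hθfib (ℓ t) htρ).1]
      simp only [hℓ, ContinuousLinearMap.toSpanSingleton_apply, Prod.smul_fst]
    have hc := hcorr (fun t : ℝ => θ (ℓ t)) hθℓc hθℓ0 hlin
    rw [hθℓ', hθℓ''] at hc
    have hf'' : fderiv ℝ (fderiv ℝ f) 0 1 1 = fderiv ℝ (fderiv ℝ A) 0 X X + fderiv ℝ A 0 (fderiv ℝ (fderiv ℝ θ) 0 (v, X) (v, X)) := by
      have h1 : ContDiffAt ℝ 2 (fun p : ↥(skewSub 4 n N) × ↥(skewSub 4 n (L * tower L N j)) => A (θ p)) (ℓ 0) := by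
        rw [map_zero]
        have h2 : ContDiffAt ℝ 2 A (θ 0) := by rw [hθ0]; exact hAc
        exact ContDiffAt.comp (g := A) (f := θ) 0 h2 hθc
      have e1 : f = fun t => (fun p : ↥(skewSub 4 n N) × ↥(skewSub 4 n (L * tower L N j)) => A (θ p)) (ℓ t) := rfl
      rw [e1, fderiv_fderiv_comp_clm ℓ h1, map_zero, hℓ1]
      have hAθ : ContDiffAt ℝ 2 A (θ 0) := by rw [hθ0]; exact hAc
      rw [fderiv_fderiv_comp hAθ hθc, hθ0, hθ'X]
    rw [hsplit, hm'', hf'', mul_add, hc] at hφ''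
    show fderiv ℝ (fderiv ℝ m) 0 v v ≤ w * fderiv ℝ (fderiv ℝ A) 0 X X - fderiv ℝ m 0 (fderiv ℝ (fderiv ℝ G) 0 X X)
    linarith

end

end Summit.QuantumFields.BalabanUV.T4Continuum.NE7MinActHessianLagrangian
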